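import Mathlib
import Summits.Ventures.PercRepro2.OneTypedEdge
import Summits.Ventures.PercRepro2.TypedSpectator

/-!
# The root-untouched vanishing of the typed bases (blind cell PercRepro2, night-3 g5, 2026-08-25;
`proofs/NIGHT3-CERT.md` §14)

**Every typed base of row 2′TRI vanishes when no typed edge touches the pinned cluster of a
root.**  If no edge of `F` has an end in `C_z(a₁)` (the cluster of `a₁` in the pinned configuration
`z`), then every copy of every typed triple has the same cluster of `a₁` — the state coordinates
`q′ = [a₂ ↔ a₁]`, `L_o`, `L_b`, `L₃` are constant on the support — and the `S₃`-symmetrised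
kernel `K₃` vanishes identically on state triples with a common `(q′, L)`-part
(`KBsym_eq_zero_of_L`, a `decide` over the 8,192 such triples); with the copy symmetry of the typed
count this gives `typedCount F z τ K₃ = 0` (`typedCount_eq_zero_of_untouched_a1`).  The mirror
statement for `a₂` (`typedCount_eq_zero_of_untouched_a2`) is the same argument with the
`(q′, H)`-part.

Reading (equality locus of the census): a nonzero typed base needs typed edges at BOTH root
clusters; the one-typed-edge vanishing of `OneTypedEdge.lean` is the case where one root is
untouched (a single edge touching both roots is the root-pair rule).  In the weighted language:
`Gc = D · P(Q) · G` vanishes identically on every face of the cube whose fractional edges avoid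
the cluster of a root in the pinned-open graph (the covariance form has no content unless both
root clusters are random).
-/

namespace Summit.Ventures.PercRepro2

open UnionCluster

namespace CovForm

namespace Untouched

open OneTyped TypedA3

/-! ## The symmetrised kernel on states with a common root part -/

section States

/-- A state assembled from its `(q′, L_o, L_b, L₃)`-part and its `(H_o, H_b, H₃)`-part (the
coordinate order of `St` is `(q′, L_o, H_o, L_b, H_b, L₃, H₃)`). -/
def mkSt (q Lo Lb L3 Ho Hb H3 : Bool) : St := (q, Lo, Ho, Lb, Hb, L3, H3)

/-- The `S₃`-symmetrisation of the kernel on states. -/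
def KBsym (x y z : St) : ℤ :=
  KB x y z + KB x z y + KB y x z + KB y z x + KB z x y + KB z y x

/-- **The symmetrised kernel vanishes on state triples with a common `(q′, L)`-part**
(8,192 cases). -/
theorem KBsym_eq_zero_of_L (q Lo Lb L3 Ho Hb H3 Ho' Hb' H3' Ho'' Hb'' H3'' : Bool) :
    KBsym (mkSt q Lo Lb L3 Ho Hb H3) (mkSt q Lo Lb L3 Ho' Hb' H3')
      (mkSt q Lo Lb L3 Ho'' Hb'' H3'') = 0 := by
  revert q Lo Lb L3 Ho Hb H3 Ho' Hb' H3' Ho'' Hb'' H3''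
  decide +kernel

/-- **The symmetrised kernel vanishes on state triples with a common `(q′, H)`-part**
(8,192 cases; the `l ↔ h` mirror). -/
theorem KBsym_eq_zero_of_H (q Ho Hb H3 Lo Lb L3 Lo' Lb' L3' Lo'' Lb'' L3'' : Bool) :
    KBsym (mkSt q Lo Lb L3 Ho Hb H3) (mkSt q Lo' Lb' L3' Ho Hb H3)
      (mkSt q Lo'' Lb'' L3'' Ho Hb H3) = 0 := by
  revert q Ho Hb H3 Lo Lb L3 Lo' Lb' L3' Lo'' Lb'' L3''
  decide +kernel

end States

/-! ## Untouched clusters are constant on the support -/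

section Cluster

variable {V : Type*} {E : Type*}

/-- No edge of `F` touches the cluster of `v` in `z`. -/
def UntouchedBy (ends : E → Sym2 V) (F : Finset E) (z : Config E) (v : V) : Prop :=
  ∀ e ∈ F, e ∉ touches ends (cluster ends z v)

/-- If no edge of `F` touches `C_z(v)`, every configuration agreeing with `z` off `F` has the same
cluster of `v` (the domain Markov property of `Graph.lean`). -/
lemma cluster_eq_of_untouchedBy {ends : E → Sym2 V} {F : Finset E} {z : Config E} {v : V}
    (h : UntouchedBy ends F z v) {ω : Config E} (hω : ∀ e, e ∉ F → ω e = z e) :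
    cluster ends ω v = cluster ends z v :=
  cluster_eq_of_eqOn_touches (ω := z) (ω' := ω)
    (fun e he => (hω e (fun heF => h e heF he)).symm) rfl

/-- The connections from `v` are those of `z`. -/
lemma conn_iff_of_untouchedBy {ends : E → Sym2 V} {F : Finset E} {z : Config E} {v : V}
    (h : UntouchedBy ends F z v) {ω : Config E} (hω : ∀ e, e ∉ F → ω e = z e) (u : V) :
    Conn ends ω v u ↔ Conn ends z v u := by
  have hc := cluster_eq_of_untouchedBy h hω
  have h1 : u ∈ cluster ends ω v ↔ u ∈ cluster ends z v := by rw [hc]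
  simpa [cluster] using h1

end Cluster

/-! ## The states on the support -/

section StateSupport

open Classical

variable {V : Type*} {E : Type*} [Fintype E] [DecidableEq E]
variable (ends : E → Sym2 V) (o a₁ a₂ a₃ b : V)

omit [Fintype E] [DecidableEq E] in
/-- With `C(a₁)` untouched, the state of `ω` has the `(q′, L)`-part of `z`. -/
lemma st_eq_mkSt_of_untouched_a1 {F : Finset E} {z : Config E}
    (h : UntouchedBy ends F z a₁) {ω : Config E} (hω : ∀ e, e ∉ F → ω e = z e) :
    st ends o a₁ a₂ a₃ b ω =
      mkSt (decide (Conn ends z a₂ a₁)) (decide (Conn ends z a₁ o)) (decide (Conn ends z a₁ b))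
        (decide (Conn ends z a₁ a₃)) (decide (Conn ends ω a₂ o)) (decide (Conn ends ω a₂ b))
        (decide (Conn ends ω a₂ a₃)) := by
  have hq : Conn ends ω a₂ a₁ ↔ Conn ends z a₂ a₁ := by
    constructor
    · intro hc; exact conn_symm ((conn_iff_of_untouchedBy h hω a₂).1 (conn_symm hc))
    · intro hc; exact conn_symm ((conn_iff_of_untouchedBy h hω a₂).2 (conn_symm hc))
  unfold st mkSt
  rw [decide_eq_decide.mpr hq, decide_eq_decide.mpr (conn_iff_of_untouchedBy h hω o),
    decide_eq_decide.mpr (conn_iff_of_untouchedBy h hω b),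
    decide_eq_decide.mpr (conn_iff_of_untouchedBy h hω a₃)]

omit [Fintype E] [DecidableEq E] in
/-- With `C(a₂)` untouched, the state of `ω` has the `(q′, H)`-part of `z`. -/
lemma st_eq_mkSt_of_untouched_a2 {F : Finset E} {z : Config E}
    (h : UntouchedBy ends F z a₂) {ω : Config E} (hω : ∀ e, e ∉ F → ω e = z e) :
    st ends o a₁ a₂ a₃ b ω =
      mkSt (decide (Conn ends z a₂ a₁)) (decide (Conn ends ω a₁ o)) (decide (Conn ends ω a₁ b))
        (decide (Conn ends ω a₁ a₃)) (decide (Conn ends z a₂ o)) (decide (Conn ends z a₂ b))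
        (decide (Conn ends z a₂ a₃)) := by
  unfold st mkSt
  rw [decide_eq_decide.mpr (conn_iff_of_untouchedBy h hω a₁),
    decide_eq_decide.mpr (conn_iff_of_untouchedBy h hω o),
    decide_eq_decide.mpr (conn_iff_of_untouchedBy h hω b),
    decide_eq_decide.mpr (conn_iff_of_untouchedBy h hω a₃)]

end StateSupport

/-! ## The theorem -/

section Main

open Classical

variable {V : Type*} {E : Type*} [Fintype E] [DecidableEq E] {R : Type*} [Field R]
  [LinearOrder R] [IsStrictOrderedRing R]
variable (ends : E → Sym2 V) (o a₁ a₂ a₃ b : V)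

omit [LinearOrder R] [IsStrictOrderedRing R] in
/-- Kernels that agree on the support of the typed count have equal typed counts. -/
lemma typedCount_congr_on_support (F : Finset E) (z : Config E) (τ : E → ℕ)
    {K K' : Config E → Config E → Config E → R}
    (h : ∀ x y w, (∀ e, e ∉ F → x e = z e ∧ y e = z e ∧ w e = z e) →
      (∀ e ∈ F, openCount x y w e = τ e) → K x y w = K' x y w) :
    typedCount F z τ K = typedCount F z τ K' := by
  unfold typedCount
  refine Finset.sum_congr rfl fun x _ => Finset.sum_congr rfl fun y _ =>
    Finset.sum_congr rfl fun w _ => ?_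
  split_ifs with hc
  · exact h x y w hc.1 hc.2
  · rfl

omit [LinearOrder R] [IsStrictOrderedRing R] in
/-- The typed count of the zero kernel. -/
lemma typedCount_zero_kernel (F : Finset E) (z : Config E) (τ : E → ℕ) :
    typedCount F z τ (fun _ _ _ => (0 : R)) = 0 := by
  unfold typedCount
  simp

omit [LinearOrder R] [IsStrictOrderedRing R] in
/-- Six times the typed count of a kernel is the typed count of its `S₃`-symmetrisation
(types in `{1, 2}` on `F`). -/
lemma six_mul_typedCount (F : Finset E) (z : Config E) (τ : E → ℕ)
    (hτ : ∀ e ∈ F, τ e = 1 ∨ τ e = 2) (K : Config E → Config E → Config E → R) :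
    6 * typedCount F z τ K =
      typedCount F z τ (fun x y w =>
        K x y w + K x w y + K y x w + K y w x + K w x y + K w y x) := by
  have e1 := typedCount_add' F z τ
    (fun x y w => K x y w + K x w y + K y x w + K y w x + K w x y) (fun x y w => K w y x)
  have e2 := typedCount_add' F z τ
    (fun x y w => K x y w + K x w y + K y x w + K y w x) (fun x y w => K w x y)
  have e3 := typedCount_add' F z τ
    (fun x y w => K x y w + K x w y + K y x w) (fun x y w => K y w x)
  have e4 := typedCount_add' F z τ (fun x y w => K x y w + K x w y) (fun x y w => K y x w)
  have e5 := typedCount_add' F z τ (fun x y w => K x y w) (fun x y w => K x w y)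
  have s23 := typedCount_swap23 F z τ hτ K
  have s12 := typedCount_swap12 F z τ K
  have s13 := typedCount_swap13 F z τ hτ K
  have c1 : typedCount F z τ (fun x y w => K y w x) = typedCount F z τ K := by
    have := typedCount_swap12 F z τ (fun x y w => K x w y)
    exact this.trans s23
  have c2 : typedCount F z τ (fun x y w => K w x y) = typedCount F z τ K := by
    have := typedCount_swap12 F z τ (fun x y w => K w y x)
    exact this.trans s13
  have hK : typedCount F z τ (fun x y w => K x y w) = typedCount F z τ K := rfl
  rw [e1, e2, e3, e4, e5, hK, s23, s12, c1, c2, s13]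
  ring

/-- **Root-untouched vanishing, `a₁`**: if no typed edge touches the cluster of `a₁` in the pinned
configuration `z`, the typed base vanishes. -/
theorem typedCount_eq_zero_of_untouched_a1 (F : Finset E) (z : Config E) (τ : E → ℕ)
    (hτ : ∀ e ∈ F, τ e = 1 ∨ τ e = 2) (h : UntouchedBy ends F z a₁) :
    typedCount F z τ (K3 ends o a₁ a₂ a₃ b : Config E → Config E → Config E → R) = 0 := by
  have h6 := six_mul_typedCount F z τ hτ (K3 ends o a₁ a₂ a₃ b : Config E → Config E → Config E → R)
  have hzero : typedCount F z τ (fun x y w : Config E =>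
      (K3 ends o a₁ a₂ a₃ b x y w : R) + K3 ends o a₁ a₂ a₃ b x w y + K3 ends o a₁ a₂ a₃ b y x w +
        K3 ends o a₁ a₂ a₃ b y w x + K3 ends o a₁ a₂ a₃ b w x y + K3 ends o a₁ a₂ a₃ b w y x) =
      typedCount F z τ (fun _ _ _ => (0 : R)) := by
    refine typedCount_congr_on_support F z τ fun x y w hxyw _ => ?_
    have hx : ∀ e, e ∉ F → x e = z e := fun e he => (hxyw e he).1
    have hy : ∀ e, e ∉ F → y e = z e := fun e he => (hxyw e he).2.1
    have hw : ∀ e, e ∉ F → w e = z e := fun e he => (hxyw e he).2.2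
    simp only [K3_eq_KB ends o a₁ a₂ a₃ b, st_eq_mkSt_of_untouched_a1 ends o a₁ a₂ a₃ b h hx,
      st_eq_mkSt_of_untouched_a1 ends o a₁ a₂ a₃ b h hy,
      st_eq_mkSt_of_untouched_a1 ends o a₁ a₂ a₃ b h hw]
    have := KBsym_eq_zero_of_L (decide (Conn ends z a₂ a₁)) (decide (Conn ends z a₁ o))
      (decide (Conn ends z a₁ b)) (decide (Conn ends z a₁ a₃))
      (decide (Conn ends x a₂ o)) (decide (Conn ends x a₂ b)) (decide (Conn ends x a₂ a₃))
      (decide (Conn ends y a₂ o)) (decide (Conn ends y a₂ b)) (decide (Conn ends y a₂ a₃))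
      (decide (Conn ends w a₂ o)) (decide (Conn ends w a₂ b)) (decide (Conn ends w a₂ a₃))
    unfold KBsym at this
    exact_mod_cast this
  rw [hzero, typedCount_zero_kernel] at h6
  have h6' : (6 : R) ≠ 0 := by norm_num
  exact (mul_eq_zero.mp h6).resolve_left h6'

/-- **Root-untouched vanishing, `a₂`**: the mirror statement. -/
theorem typedCount_eq_zero_of_untouched_a2 (F : Finset E) (z : Config E) (τ : E → ℕ)
    (hτ : ∀ e ∈ F, τ e = 1 ∨ τ e = 2) (h : UntouchedBy ends F z a₂) :
    typedCount F z τ (K3 ends o a₁ a₂ a₃ b : Config E → Config E → Config E → R) = 0 := by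
  have h6 := six_mul_typedCount F z τ hτ (K3 ends o a₁ a₂ a₃ b : Config E → Config E → Config E → R)
  have hzero : typedCount F z τ (fun x y w : Config E =>
      (K3 ends o a₁ a₂ a₃ b x y w : R) + K3 ends o a₁ a₂ a₃ b x w y + K3 ends o a₁ a₂ a₃ b y x w +
        K3 ends o a₁ a₂ a₃ b y w x + K3 ends o a₁ a₂ a₃ b w x y + K3 ends o a₁ a₂ a₃ b w y x) =
      typedCount F z τ (fun _ _ _ => (0 : R)) := by
    refine typedCount_congr_on_support F z τ fun x y w hxyw _ => ?_
    have hx : ∀ e, e ∉ F → x e = z e := fun e he => (hxyw e he).1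
    have hy : ∀ e, e ∉ F → y e = z e := fun e he => (hxyw e he).2.1
    have hw : ∀ e, e ∉ F → w e = z e := fun e he => (hxyw e he).2.2
    simp only [K3_eq_KB ends o a₁ a₂ a₃ b, st_eq_mkSt_of_untouched_a2 ends o a₁ a₂ a₃ b h hx,
      st_eq_mkSt_of_untouched_a2 ends o a₁ a₂ a₃ b h hy,
      st_eq_mkSt_of_untouched_a2 ends o a₁ a₂ a₃ b h hw]
    have := KBsym_eq_zero_of_H (decide (Conn ends z a₂ a₁)) (decide (Conn ends z a₂ o))
      (decide (Conn ends z a₂ b)) (decide (Conn ends z a₂ a₃))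
      (decide (Conn ends x a₁ o)) (decide (Conn ends x a₁ b)) (decide (Conn ends x a₁ a₃))
      (decide (Conn ends y a₁ o)) (decide (Conn ends y a₁ b)) (decide (Conn ends y a₁ a₃))
      (decide (Conn ends w a₁ o)) (decide (Conn ends w a₁ b)) (decide (Conn ends w a₁ a₃))
    unfold KBsym at this
    exact_mod_cast this
  rw [hzero, typedCount_zero_kernel] at h6
  have h6' : (6 : R) ≠ 0 := by norm_num
  exact (mul_eq_zero.mp h6).resolve_left h6'

/-- **Both roots must be touched**: a nonzero typed base has a typed edge at the pinned cluster of
`a₁` and one at the pinned cluster of `a₂`. -/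
theorem exists_touching_of_typedCount_ne_zero (F : Finset E) (z : Config E) (τ : E → ℕ)
    (hτ : ∀ e ∈ F, τ e = 1 ∨ τ e = 2)
    (hne : typedCount F z τ (K3 ends o a₁ a₂ a₃ b : Config E → Config E → Config E → R) ≠ 0) :
    (∃ e ∈ F, e ∈ touches ends (cluster ends z a₁)) ∧
      (∃ e ∈ F, e ∈ touches ends (cluster ends z a₂)) := by
  constructor
  · by_contra hc
    exact hne (typedCount_eq_zero_of_untouched_a1 ends o a₁ a₂ a₃ b F z τ hτ
      fun e he ht => hc ⟨e, he, ht⟩)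
  · by_contra hc
    exact hne (typedCount_eq_zero_of_untouched_a2 ends o a₁ a₂ a₃ b F z τ hτ
      fun e he ht => hc ⟨e, he, ht⟩)

end Main

end Untouched

end CovForm

end Summit.Ventures.PercRepro2
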